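import Summits.CriticalPhenomena.PercolationContinuityZ3.Theorems.PercNearOneGluingNoHeavyQuantLightSliceLowCrossGiant
import Summits.CriticalPhenomena.PercolationContinuityZ3.Theorems.PercNearOneGluingNoHeavyQuantLightSliceLowCrossBelow
import Summits.CriticalPhenomena.PercolationContinuityZ3.Theorems.PercNearOneGluingNoHeavyQuantLightSliceAssembly
import HarnessLib

/-!
# QUANT lane R8, T-DEC: THE LOW-CROSS SPLIT — `LightSliceLowCross ⟸ LightSliceLowCrossBelow` (the crossed class with the lower cross cell a giant
# being a theorem), hence `FarTreeRow ⟸ LightSliceLowCrossBelow ∧ LightSliceWide ∧ (III)` (census-2 g59)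

builds on p205010 (kernel theorem, internal audit signed; external expert review pending)

Support file (`--supports stmt-CriticalPhenomena-4575`), QUANT lane seat prim-quant-census-2 (gen 59), rung R8 of
`run/shared/lean/prim/quant/LADDER.md`.  Theorems only, standard axioms, no sorries, no definitions.  Memo
`run/shared/lean/prim/quant/prim-quant-census-2-g59/ASSEMBLY-G59.md` §5.

* **`LawDec.lightSliceLowCross_of_below : LightSliceLowCrossBelow → LightSliceLowCross`** — case `j + 1 ≤ l₁′ + h₂` by
  `lightSlice_decAtT_lowCross_crossGiant`, case `l₁′ + h₂ ≤ j` by the hypothesis.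
* `lightSliceCore_of_below`, `convClosedT_of_below`, **`Quant.farTreeRow_of_below : LightSliceLowCrossBelow → LightSliceWide → GatedConvEmptyFree →
  FarTreeRow`** (+ `_gateMove`).
STATE of the R8 law level after this file: **`FarTreeRow ⟸ LightSliceLowCrossBelow ∧ LightSliceWide ∧ (GatedConvEmptyFree ∨ GateMove)`**.
HONEST: the three named statements are `@[conjecture]` (open); RATE class log* / honest sentence unchanged.

[this work]; nothing here is cited as a published result.  The gluing rows served [cite: KozmaNitzan2024, Conjecture 3 (p. 15)]; product
measure [cite: Grimmett1999, §1.3 p. 10].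
-/

noncomputable section

namespace Summit.CriticalPhenomena.PercolationContinuityZ3.Theorems

namespace Quant

open Finset

namespace LawDec

/-- **`LightSliceLowCross ⟸ LightSliceLowCrossBelow`.** [this work] -/
theorem lightSliceLowCross_of_below (hB : LightSliceLowCrossBelow) : LightSliceLowCross := by
  intro x T₁ T₂ M₁ M₂ j l₁ h₁ l₁' h₁' l₂ h₂ l₂' h₂' hx0 hx1 hj hd₁ hd₂ ho₁ ho₂ ho₃ ho₄ hw₁ hw₂ hb₁ hb₂ hdeep₁ hdeep₂ hA2 htie htop hlow
  by_cases hcg : j + 1 ≤ l₁' + h₂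
  · obtain ⟨-, -, -, -, -, -, b2, b3, b4, b5, -, c2, -⟩ := hd₁
    exact lightSlice_decAtT_lowCross_crossGiant x T₁ T₂ M₁ M₂ j l₁' h₁' l₂ h₂ l₂' h₂' hx0 hx1 b2 b3 b4 b5 c2 hd₂ ho₃ ho₄ hdeep₁ hA2
      htop hlow hcg
  · push Not at hcg
    exact hB x T₁ T₂ M₁ M₂ j l₁ h₁ l₁' h₁' l₂ h₂ l₂' h₂' hx0 hx1 hj hd₁ hd₂ ho₁ ho₂ ho₃ ho₄ hw₁ hw₂ hb₁ hb₂ hdeep₁ hdeep₂ hA2 htie htop hlow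
      (by omega)

/-- **`LightSliceCore ⟸ LightSliceLowCrossBelow ∧ LightSliceWide`.** [this work] -/
theorem lightSliceCore_of_below (hB : LightSliceLowCrossBelow) (hW : LightSliceWide) : LightSliceCore :=
  lightSliceCore_of_residual (lightSliceLowCross_of_below hB) hW

/-- **`ConvClosedT ⟸ LightSliceLowCrossBelow ∧ LightSliceWide`.** [this work] -/
theorem convClosedT_of_below (hB : LightSliceLowCrossBelow) (hW : LightSliceWide) : ConvClosedT :=
  convClosedT_of_residual (lightSliceLowCross_of_below hB) hW

end LawDec

/-- **`Quant.FarTreeRow ⟸ LightSliceLowCrossBelow ∧ LightSliceWide ∧ GatedConvEmptyFree`.**  CONDITIONAL: all three are `@[conjecture]`.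
[this work] -/
theorem farTreeRow_of_below (hB : LawDec.LightSliceLowCrossBelow) (hW : LawDec.LightSliceWide) (hIII : LawDec.GatedConvEmptyFree) :
    FarTreeRow :=
  farTreeRow_of_residual (LawDec.lightSliceLowCross_of_below hB) hW hIII

/-- **`Quant.FarTreeRow ⟸ LightSliceLowCrossBelow ∧ LightSliceWide ∧ GateMove`.**  CONDITIONAL. [this work] -/
theorem farTreeRow_of_below_gateMove (hB : LawDec.LightSliceLowCrossBelow) (hW : LawDec.LightSliceWide) (hG : LawDec.GateMove) :
    FarTreeRow :=
  farTreeRow_of_residual_gateMove (LawDec.lightSliceLowCross_of_below hB) hW hG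

end Quant

end Summit.CriticalPhenomena.PercolationContinuityZ3.Theorems
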